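import Mathlib
import Summits.CriticalPhenomena.Ising3DConformalLimit.Theorems.MarkovRigidityFieldRealisationKernelBound
import Summits.CriticalPhenomena.Ising3DConformalLimit.Theorems.HyperoctahedralRPInversionUpgradeNormalisedGaussianDomination
import Summits.CriticalPhenomena.Ising3DConformalLimit.Theorems.RotationUpgradeFromTwoPoint.Negative.NondegeneracyRedundant
import Summits.CriticalPhenomena.Ising3DConformalLimit.Theorems.MoebiusLimitExists.Negative.RatioRegular
import Literature.MathematicalPhysics.QuantumLattice.LatticeScalarField
import HarnessLib

/-!
# Route MarkovRigidity, support item `FieldRealisation` (stmt-CriticalPhenomena-11245):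
# mesh cells, smeared sums as integrals, and the pointwise Gaussian domination

Third helper towards clause (b) of `FieldRealisation`.  The smeared `n`-point sum of the critical
correlators against weights `gᵢ` over a box `Λ`,
`Σ_{z ∈ Λⁿ} (∏ᵢ ρ(δ) δ³ gᵢ(δzᵢ)) ⟨∏ᵢ σ_{zᵢ}⟩_{β_c}`, is the integral over `(ℝ³)ⁿ` of the step function
`x ↦ 𝟙[⌊x/δ⌋ ∈ Λⁿ] (∏ᵢ gᵢ(δ⌊xᵢ/δ⌋)) · ρ(δ)ⁿ⟨∏ σ_{⌊xᵢ/δ⌋}⟩` (`smearedSum_eq_integral`: each mesh cell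
has volume `δ^{3n}`), and this step function is dominated on non-coincident configurations,
uniformly in the mesh, by a multiple of the Wick pairing functional of the continuum kernel
`max(1, ‖p−q‖^{-a})` (`rescaledCorrelator_le_pairingSum_kernel`: Newman's Gaussian inequality in
index form, tree `rescaledCorrelator_le_pairingSum_index`, the mesh-uniform kernel bound
`rho_sq_mul_criticalTwoPoint_le`, and the elementary comparison `‖q−p‖ ≤ 4δ·max(1,‖⌊q/δ⌋−⌊p/δ⌋‖_∞)`).
These are the two inputs of the dominated-convergence argument of the next file.

References: Glimm–Jaffe 1987 §6.1; Aizenman–Duminil-Copin 2021 §6.3.  No definitions.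
-/

noncomputable section

namespace Summit.CriticalPhenomena.Ising3DConformalLimit.MarkovRigidityFieldRealisation

open MeasureTheory Literature.Probability.LatticeModels Literature.MathematicalPhysics.QuantumLattice
open Summit.CriticalPhenomena.Ising3DConformalLimit
open scoped ENNReal

/-! ### Mesh cells -/

/-- The mesh cell of a lattice site: `⌊y/δ⌋ = z` iff `δ z_k ≤ y_k < δ (z_k + 1)` for all `k`.
[folklore] -/
theorem latticeApprox_eq_iff {δ : ℝ} (hδ : 0 < δ) (y : (EuclideanSpace ℝ (Fin 3))) (z : Site 3) :
    latticeApprox δ y = z ↔ ∀ k, δ * z k ≤ y k ∧ y k < δ * (z k + 1) := by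
  rw [funext_iff]
  refine forall_congr' fun k => ?_
  rw [latticeApprox_apply, Int.floor_eq_iff, le_div_iff₀ hδ, div_lt_iff₀ hδ]
  constructor <;> rintro ⟨h1, h2⟩ <;> constructor <;> linarith

/-- The lattice approximation is measurable. [folklore] -/
theorem measurable_latticeApprox (δ : ℝ) : Measurable (latticeApprox δ : (EuclideanSpace ℝ (Fin 3)) → Site 3) :=
  measurable_pi_lambda _ fun k =>
    Int.measurable_floor.comp (((EuclideanSpace.proj k).continuous.measurable).div_const δ)

/-- The configuration of lattice approximations is measurable. [folklore] -/
theorem measurable_cfg (n : ℕ) (δ : ℝ) :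
    Measurable (fun x : Fin n → (EuclideanSpace ℝ (Fin 3)) => fun i => latticeApprox δ (x i)) :=
  measurable_pi_lambda _ fun i => (measurable_latticeApprox δ).comp (measurable_pi_apply i)

/-- A mesh cell of `ℝ³` has volume `δ³`. [folklore] -/
theorem volume_latticeApprox_eq {δ : ℝ} (hδ : 0 < δ) (z : Site 3) :
    volume {y : (EuclideanSpace ℝ (Fin 3)) | latticeApprox δ y = z} = ENNReal.ofReal (δ ^ 3) := by
  have hmp := PiLp.volume_preserving_ofLp (Fin 3)
  have hset : {y : (EuclideanSpace ℝ (Fin 3)) | latticeApprox δ y = z} =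
      (WithLp.ofLp : (EuclideanSpace ℝ (Fin 3)) → (Fin 3 → ℝ)) ⁻¹'
        (Set.pi Set.univ fun k => Set.Ico (δ * z k) (δ * (z k + 1))) := by
    ext y
    simp only [Set.mem_setOf_eq, latticeApprox_eq_iff hδ, Set.mem_preimage, Set.mem_univ_pi,
      Set.mem_Ico]
  rw [hset, hmp.measure_preimage (MeasurableSet.univ_pi fun _ => measurableSet_Ico).nullMeasurableSet,
    volume_pi_pi]
  simp only [Real.volume_Ico]
  have h : ∀ x : Fin 3, ENNReal.ofReal (δ * ((z x : ℝ) + 1) - δ * (z x : ℝ)) = ENNReal.ofReal δ :=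
    fun x => by congr 1; ring
  simp_rw [h]
  rw [Finset.prod_const, Finset.card_univ, Fintype.card_fin, ← ENNReal.ofReal_pow hδ.le]

/-- A mesh cell of `(ℝ³)ⁿ` has volume `δ^{3n}`. [folklore] -/
theorem volume_cfg_eq {δ : ℝ} (hδ : 0 < δ) {n : ℕ} (z : Fin n → Site 3) :
    volume {x : Fin n → (EuclideanSpace ℝ (Fin 3)) | (fun i => latticeApprox δ (x i)) = z} = ENNReal.ofReal (δ ^ (3 * n)) := by
  have hset : {x : Fin n → (EuclideanSpace ℝ (Fin 3)) | (fun i => latticeApprox δ (x i)) = z} =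
      Set.pi Set.univ fun i => {y : (EuclideanSpace ℝ (Fin 3)) | latticeApprox δ y = z i} := by
    ext x; simp [funext_iff]
  rw [hset, volume_pi_pi]
  simp only [volume_latticeApprox_eq hδ, Finset.prod_const, Finset.card_univ, Fintype.card_fin]
  rw [← ENNReal.ofReal_pow (by positivity), ← pow_mul]

/-- **Integrals of step functions on the mesh**: for `Ψ` supported in a finite set `T` of lattice
configurations, `∫ Ψ(⌊x/δ⌋) dx = δ^{3n} Σ_{z ∈ T} Ψ(z)`. [folklore] -/
theorem integral_comp_cfg {δ : ℝ} (hδ : 0 < δ) {n : ℕ} (Ψ : (Fin n → Site 3) → ℝ)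
    (T : Finset (Fin n → Site 3)) (hΨ : ∀ z, z ∉ T → Ψ z = 0) :
    ∫ x : Fin n → (EuclideanSpace ℝ (Fin 3)), Ψ (fun i => latticeApprox δ (x i)) = δ ^ (3 * n) * ∑ z ∈ T, Ψ z := by
  classical
  have hmeas : ∀ z, MeasurableSet {x : Fin n → (EuclideanSpace ℝ (Fin 3)) | (fun i => latticeApprox δ (x i)) = z} := fun z =>
    (measurable_cfg n δ) (measurableSet_singleton z)
  have hpt : ∀ x : Fin n → (EuclideanSpace ℝ (Fin 3)), Ψ (fun i => latticeApprox δ (x i)) =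
      ∑ z ∈ T, {x : Fin n → (EuclideanSpace ℝ (Fin 3)) | (fun i => latticeApprox δ (x i)) = z}.indicator (fun _ => Ψ z) x := by
    intro x
    by_cases hx : (fun i => latticeApprox δ (x i)) ∈ T
    · rw [Finset.sum_eq_single (fun i => latticeApprox δ (x i))]
      · rw [Set.indicator_of_mem (by simp)]
      · intro z _ hz
        rw [Set.indicator_of_notMem]
        simpa [eq_comm] using hz
      · exact fun h => (h hx).elim
    · rw [hΨ _ hx, Finset.sum_eq_zero]
      intro z hz
      rw [Set.indicator_of_notMem]
      intro h
      exact hx (by rw [Set.mem_setOf_eq] at h; rwa [h])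
  simp_rw [hpt]
  rw [integral_finsetSum _ fun z _ => ?_]
  · rw [Finset.mul_sum]
    refine Finset.sum_congr rfl fun z _ => ?_
    rw [integral_indicator_const _ (hmeas z), measureReal_def, volume_cfg_eq hδ,
      ENNReal.toReal_ofReal (by positivity), smul_eq_mul]
  · rw [integrable_indicator_iff (hmeas z), integrableOn_const_iff]
    right
    rw [volume_cfg_eq hδ]
    exact ENNReal.ofReal_lt_top

/-! ### Smeared sums as integrals -/

/-- **The smeared `n`-point sum is the integral of a step function.**  For a box `Λ`, weights
`gᵢ : ℝ³ → ℝ`, a renormalisation `ρ` and a mesh `δ > 0`,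
`Σ_{z ∈ Λⁿ} (∏ᵢ ρ(δ) δ³ gᵢ(δzᵢ)) ⟨∏ᵢσ_{zᵢ}⟩_{β_c}
  = ∫ 𝟙[∀ i, ⌊xᵢ/δ⌋ ∈ Λ] (∏ᵢ gᵢ(δ⌊xᵢ/δ⌋)) · ρ(δ)ⁿ⟨∏ᵢ σ_{⌊xᵢ/δ⌋}⟩_{β_c} dx`.
[cite: GlimmJaffe1987, §6.1] -/
theorem smearedSum_eq_integral (ρ : ℝ → ℝ) {δ : ℝ} (hδ : 0 < δ) {n : ℕ} (Λ : Finset (Site 3))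
    (g : Fin n → (EuclideanSpace ℝ (Fin 3)) → ℝ) :
    ∑ z ∈ Fintype.piFinset (fun _ : Fin n => Λ),
        (∏ i, ρ δ * δ ^ 3 * g i (δ • siteToE (z i))) * criticalCorr 3 n z =
      ∫ x : Fin n → (EuclideanSpace ℝ (Fin 3)), if (∀ i, latticeApprox δ (x i) ∈ Λ) then
        (∏ i, g i (δ • siteToE (latticeApprox δ (x i)))) *
          rescaledCorrelator (criticalCorr 3) ρ n δ x else 0 := by
  classical
  set Ψ : (Fin n → Site 3) → ℝ := fun z => if (∀ i, z i ∈ Λ) then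
    (∏ i, g i (δ • siteToE (z i))) * (ρ δ ^ n * criticalCorr 3 n z) else 0 with hΨ
  have hF : (fun x : Fin n → (EuclideanSpace ℝ (Fin 3)) => if (∀ i, latticeApprox δ (x i) ∈ Λ) then
      (∏ i, g i (δ • siteToE (latticeApprox δ (x i)))) *
        rescaledCorrelator (criticalCorr 3) ρ n δ x else 0) =
      fun x => Ψ (fun i => latticeApprox δ (x i)) := by
    funext x; simp only [hΨ, rescaledCorrelator_apply]
  rw [hF, integral_comp_cfg hδ Ψ (Fintype.piFinset fun _ => Λ) fun z hz => by
    rw [hΨ]; dsimp only; rw [if_neg]; simpa [Fintype.mem_piFinset] using hz]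
  rw [Finset.mul_sum]
  refine Finset.sum_congr rfl fun z hz => ?_
  have hzΛ : ∀ i, z i ∈ Λ := by simpa [Fintype.mem_piFinset] using hz
  rw [hΨ]; dsimp only; rw [if_pos hzΛ, Finset.prod_mul_distrib, Finset.prod_const, Finset.card_univ,
    Fintype.card_fin, mul_pow, ← pow_mul, mul_comm 3 n]
  ring

/-! ### The mesh-uniform Gaussian domination at non-coincident configurations -/

/-- Floor discrepancy: `‖q − p‖ ≤ 4 δ · max(1, ‖⌊q/δ⌋ − ⌊p/δ⌋‖_∞)`. [folklore] -/
theorem norm_sub_le_latticeApprox {δ : ℝ} (hδ : 0 < δ) (p q : (EuclideanSpace ℝ (Fin 3))) :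
    ‖q - p‖ ≤ 4 * (δ * max 1 (Site.supNorm (latticeApprox δ q - latticeApprox δ p) : ℝ)) := by
  set u : Site 3 := latticeApprox δ q - latticeApprox δ p with hu
  have hcoord : ∀ k, |(q - p) k| ≤ 2 * (δ * max 1 (Site.supNorm u : ℝ)) := by
    intro k
    have hq := Int.floor_le (q k / δ)
    have hq' := Int.lt_floor_add_one (q k / δ)
    have hp := Int.floor_le (p k / δ)
    have hp' := Int.lt_floor_add_one (p k / δ)
    rw [div_lt_iff₀ hδ] at hq' hp'
    rw [le_div_iff₀ hδ] at hq hp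
    have huk : (u k : ℝ) = (⌊q k / δ⌋ : ℝ) - (⌊p k / δ⌋ : ℝ) := by
      rw [hu]; simp [latticeApprox_apply]
    have habs : |(u k : ℝ)| ≤ max 1 (Site.supNorm u : ℝ) := by
      have h1 : ((u k).natAbs : ℝ) ≤ Site.supNorm u := by exact_mod_cast Site.natAbs_le_supNorm u k
      rw [Nat.cast_natAbs, Int.cast_abs] at h1
      exact h1.trans (le_max_right _ _)
    have hsub : (q - p) k = q k - p k := rfl
    rw [hsub, abs_le]
    have h1 : (1 : ℝ) ≤ max 1 (Site.supNorm u : ℝ) := le_max_left _ _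
    rw [abs_le] at habs
    constructor <;> nlinarith [habs.1, habs.2, huk]
  calc ‖q - p‖ ≤ 2 * (2 * (δ * max 1 (Site.supNorm u : ℝ))) :=
        MoebiusLimitExistsNegative.norm_le_two_mul_of_abs_le hcoord
    _ = _ := by ring

/-- The mesh kernel is dominated by the continuum kernel: for `p ≠ q` and `a ≥ 0`,
`max(1, (δ·max(1,‖⌊q/δ⌋−⌊p/δ⌋‖_∞))^{-a}) ≤ 4^a · max(1, ‖q−p‖^{-a})`. [folklore] -/
theorem mesh_kernel_le {δ a : ℝ} (hδ : 0 < δ) (ha : 0 ≤ a) {p q : (EuclideanSpace ℝ (Fin 3))} (hpq : p ≠ q) :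
    max 1 ((δ * max 1 (Site.supNorm (latticeApprox δ q - latticeApprox δ p) : ℝ)) ^ (-a)) ≤
      (4 : ℝ) ^ a * max 1 (‖q - p‖ ^ (-a)) := by
  set t : ℝ := δ * max 1 (Site.supNorm (latticeApprox δ q - latticeApprox δ p) : ℝ) with ht
  have htpos : 0 < t := by positivity
  have hqp : 0 < ‖q - p‖ := norm_pos_iff.2 (sub_ne_zero.2 (Ne.symm hpq))
  have h4 : (1 : ℝ) ≤ 4 ^ a := Real.one_le_rpow (by norm_num) ha
  have hle : ‖q - p‖ / 4 ≤ t := by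
    rw [div_le_iff₀ (by norm_num)]; linarith [norm_sub_le_latticeApprox hδ p q]
  have hpow : t ^ (-a) ≤ (4 : ℝ) ^ a * ‖q - p‖ ^ (-a) := by
    calc t ^ (-a) ≤ (‖q - p‖ / 4) ^ (-a) :=
          Real.rpow_le_rpow_of_nonpos (by positivity) hle (by linarith)
      _ = (4 : ℝ) ^ a * ‖q - p‖ ^ (-a) := by
          rw [Real.div_rpow hqp.le (by norm_num), Real.rpow_neg (by norm_num : (0:ℝ) ≤ 4),
            div_eq_mul_inv, inv_inv, mul_comm]
  refine max_le ?_ (hpow.trans ?_)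
  · calc (1 : ℝ) ≤ 4 ^ a * 1 := by linarith
      _ ≤ _ := mul_le_mul_of_nonneg_left (le_max_left _ _) (by positivity)
  · exact mul_le_mul_of_nonneg_left (le_max_right _ _) (by positivity)

/-- Monotonicity of the Wick pairing functional in the kernel, index form: if
`0 ≤ T i j ≤ K (x i) (x j)` for all `i ≠ j` then `𝒢_m[T](id) ≤ 𝒢_m[K](x)`. [folklore] -/
theorem pairingSum_index_le {α : Type*} {m : ℕ} (T : Fin (2 * m) → Fin (2 * m) → ℝ)
    (K : α → α → ℝ) (x : Fin (2 * m) → α) (hT0 : ∀ i j, i ≠ j → 0 ≤ T i j)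
    (hTK : ∀ i j, i ≠ j → T i j ≤ K (x i) (x j)) :
    pairingSum T m id ≤ pairingSum K m x := by
  unfold pairingSum
  refine mul_le_mul_of_nonneg_left (Finset.sum_le_sum fun τ _ => ?_) (by positivity)
  have hne : ∀ j : Fin m, τ (pairIdx m (j, 0)) ≠ τ (pairIdx m (j, 1)) := fun j h => by
    have := (pairIdx m).injective (τ.injective h)
    simp at this
  exact Finset.prod_le_prod (fun j _ => hT0 _ _ (hne j)) fun j _ => hTK _ _ (hne j)

/-- Homogeneity of the Wick pairing functional: `𝒢_m[c·K] = cᵐ 𝒢_m[K]`. [folklore] -/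
theorem pairingSum_const_mul {α : Type*} (c : ℝ) (K : α → α → ℝ) (m : ℕ) (x : Fin (2 * m) → α) :
    pairingSum (fun p q => c * K p q) m x = c ^ m * pairingSum K m x := by
  unfold pairingSum
  simp_rw [Finset.prod_mul_distrib, Finset.prod_const, Finset.card_univ, Fintype.card_fin]
  rw [← Finset.mul_sum]
  ring

/-- **Mesh-uniform Gaussian domination of the rescaled even correlators.**  With the data
`a, C, δ₀` of `rho_sq_mul_criticalTwoPoint_le`: for `0 < δ < δ₀` and every non-coincident
`x ∈ (ℝ³)^{2m}`, `0 ≤ ρ(δ)^{2m} ⟨∏ σ_{⌊xᵢ/δ⌋}⟩_{β_c} ≤ (C 4^a)ᵐ · 𝒢_m[max(1,‖·−·‖^{-a})](x)`.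
[cite: AizenmanDuminilCopinAnnals2021, arXiv:1912.07973 §6.3, first display (p. 26)] -/
theorem rescaledCorrelator_le_pairingSum_kernel {ρ : ℝ → ℝ} {a C δ₀ : ℝ} (ha : 0 ≤ a)
    (hK : ∀ δ : ℝ, 0 < δ → δ < δ₀ → ∀ u : Site 3,
      ρ δ ^ 2 * criticalTwoPoint 3 u ≤ C * max 1 ((δ * max 1 (Site.supNorm u : ℝ)) ^ (-a)))
    {δ : ℝ} (hδ : 0 < δ) (hδ₀ : δ < δ₀) {m : ℕ} {x : Fin (2 * m) → (EuclideanSpace ℝ (Fin 3))}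
    (hx : x ∈ NonCoincident 3 (2 * m)) :
    0 ≤ rescaledCorrelator (criticalCorr 3) ρ (2 * m) δ x ∧
      rescaledCorrelator (criticalCorr 3) ρ (2 * m) δ x ≤
        (C * (4 : ℝ) ^ a) ^ m * pairingSum (fun p q : (EuclideanSpace ℝ (Fin 3)) => max 1 (‖p - q‖ ^ (-a))) m x := by
  have hC : 0 ≤ C := by
    have h := hK δ hδ hδ₀ 0
    rw [criticalTwoPoint_zero', mul_one] at h
    have h1 : max 1 ((δ * max 1 (Site.supNorm (0 : Site 3) : ℝ)) ^ (-a)) ≤ max 1 (δ ^ (-a)) := by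
      simp [Site.supNorm]
    nlinarith [sq_nonneg (ρ δ), le_max_left (1 : ℝ) ((δ * max 1 (Site.supNorm (0 : Site 3) : ℝ)) ^ (-a))]
  refine ⟨?_, ?_⟩
  · rw [rescaledCorrelator_apply]
    exact mul_nonneg (by rw [pow_mul]; exact pow_nonneg (sq_nonneg _) _)
      (RotationUpgradeFromTwoPointNegative.criticalCorr_nonneg _)
  · -- index kernel
    set T : Fin (2 * m) → Fin (2 * m) → ℝ := fun i j =>
      rescaledCorrelator (criticalCorr 3) ρ 2 δ ![x i, x j] with hT
    have hidx := Cruxes.InversionUpgradeNormalised.FreeEndpointGaussianClosure.rescaledCorrelator_le_pairingSum_index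
      ρ δ x T fun i j _ => rfl
    have hTval : ∀ i j, T i j = ρ δ ^ 2 *
        criticalTwoPoint 3 (latticeApprox δ (x j) - latticeApprox δ (x i)) := by
      intro i j
      rw [hT]; dsimp only
      rw [rescaledCorrelator_apply]
      congr 1
      have : (fun k => latticeApprox δ ((![x i, x j] : Fin 2 → (EuclideanSpace ℝ (Fin 3))) k)) =
          ![latticeApprox δ (x i), latticeApprox δ (x j)] := by
        funext k; fin_cases k <;> rfl
      rw [this, criticalCorr_two_pair]
    refine hidx.trans ?_
    rw [← pairingSum_const_mul]
    refine pairingSum_index_le T _ x (fun i j _ => ?_) fun i j hij => ?_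
    · rw [hTval]; exact mul_nonneg (sq_nonneg _) (criticalTwoPoint_nonneg' _)
    · rw [hTval]
      have hxij : x i ≠ x j := fun h => hij (hx h)
      calc ρ δ ^ 2 * criticalTwoPoint 3 (latticeApprox δ (x j) - latticeApprox δ (x i))
          ≤ C * max 1 ((δ * max 1 (Site.supNorm (latticeApprox δ (x j) - latticeApprox δ (x i)) : ℝ))
              ^ (-a)) := hK δ hδ hδ₀ _
        _ ≤ C * ((4 : ℝ) ^ a * max 1 (‖x j - x i‖ ^ (-a))) :=
            mul_le_mul_of_nonneg_left (mesh_kernel_le hδ ha hxij) hC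
        _ = C * (4 : ℝ) ^ a * max 1 (‖x i - x j‖ ^ (-a)) := by rw [norm_sub_rev]; ring

end Summit.CriticalPhenomena.Ising3DConformalLimit.MarkovRigidityFieldRealisation

end
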